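import Summits.ResolutionOfSingularities.ResolutionOfSingularities.Theorems.FrobeniusLadderFRationalResolutionIsolatedQuotientResolutionField
import HarnessLib

/-!
# Crux `FrobeniusLadder.FRationalResolution` (stmt-ResolutionOfSingularities-15317), line `redirect`,
# stub `stub_diagonalizableQuotientResolution` — ISOLATED diagonalizable quotient singularities with a `K`-RATIONAL chart point are
# resolvable over an ARBITRARY field (split étale-local forms; tame or wild, any dimension)

`…IsolatedQuotientResolutionField.hasResolution_of_isolated_quotient_charts` (✓) needs, at each singular point `x`, a point `v ↦ x` of an
étale quotient chart `φ : Spec S₀ → X` with `𝒪_{X,x} → κ(v)` onto. When the chart is a `K`-morphism and `v` is a `K`-RATIONAL point (every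
germ at `v` is congruent modulo `𝔪_v` to a constant pulled back from `Spec K`), the condition holds over ANY field `K`: the constant is pulled
back through `X` instead (`φ ≫ f = g`). This covers every singularity that is étale-locally at a rational point isomorphic to a SPLIT quotient
`𝔸ⁿ_K / D(A)` (e.g. `xy = zʳ + (higher order)` at a `K`-point), over finite and imperfect fields alike.

* `residue_condition_of_rational_point` — `K`-morphism `φ : Y → X` over `Spec K`, `v ∈ Y` `K`-rational ⇒ E-k's residue condition at `v`;
* **`hasResolution_of_isolated_quotient_charts_of_rational_points`** — `X` integral, locally of finite type over any field `K`, finitely many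
  singular points, each the image of a `K`-rational point of an étale quotient `K`-chart `Spec S₀ → X` ⇒ `Scheme.HasResolution X`.

Honest label: a corollary slice of `stub_diagonalizableQuotientResolution` (isolated, split forms at rational chart points, any field); no stub
closed by name. No definitions, no named facts, no sorry. [cite: Kato1994, (10.4)] [folklore; cite: Kollar2007, §2.2]
-/

noncomputable section

-- single-problem summit: the doubled namespace component is forced
set_option linter.dupNamespace false

open CategoryTheory AlgebraicGeometry
open Literature.AlgebraicGeometry.Resolution
open Summit.ResolutionOfSingularities.ResolutionOfSingularities.Theorems.FRationalResolution

namespace Summit.ResolutionOfSingularities.ResolutionOfSingularities.Theorems.FRationalResolution.IsolatedQuotientResolutionRational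

/-- **E-k's residue condition at a `K`-rational chart point.** Let `φ : Y → X` be a morphism over `Spec K` (`φ ≫ f = g`) and `v ∈ Y` a point
every germ at which is congruent modulo `𝔪_v` to the pull-back along `g` of a global section of `Spec K` (a `K`-rational point). Then every
germ at `v` is congruent modulo `𝔪_v` to the pull-back along `φ` of a germ at `φ v`. [folklore] -/
theorem residue_condition_of_rational_point {K : Type} [Field K] {X Y : Scheme.{0}}
    (f : X ⟶ Spec (.of K)) (g : Y ⟶ Spec (.of K)) (φ : Y ⟶ X) (hφ : φ ≫ f = g) (v : Y)
    (hv : ∀ c : Y.presheaf.stalk v, ∃ a : Γ(Spec (.of K), ⊤),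
      c - (Y.presheaf.germ ⊤ v trivial).hom (g.appTop.hom a) ∈ IsLocalRing.maximalIdeal (Y.presheaf.stalk v)) :
    ∀ c : Y.presheaf.stalk v, ∃ b : X.presheaf.stalk (φ v),
      c - (φ.stalkMap v).hom b ∈ IsLocalRing.maximalIdeal (Y.presheaf.stalk v) := by
  intro c
  obtain ⟨a, ha⟩ := hv c
  refine ⟨(X.presheaf.germ ⊤ (φ v) trivial).hom (f.appTop.hom a), ?_⟩
  have key : (φ.stalkMap v).hom ((X.presheaf.germ ⊤ (φ v) trivial).hom (f.appTop.hom a)) =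
      (Y.presheaf.germ ⊤ v trivial).hom (g.appTop.hom a) := by
    rw [← hφ, Scheme.Hom.comp_appTop]
    erw [Scheme.Hom.germ_stalkMap_apply]
    rfl
  rw [key]
  exact ha

/-- **ISOLATED diagonalizable quotient singularities with `K`-RATIONAL chart points are resolvable over ANY field (tame or wild, any
dimension).** Let `X` be integral, locally of finite type over a field `K`, with finitely many singular points, each the image `φ v` of a
`K`-RATIONAL point `v` of an étale `K`-chart `φ : Spec S₀ → X` (`φ ≫ f` the structure morphism of `Spec S₀`), where `S` is a REGULAR `K`-algebra of
finite type graded by a finite abelian group `A` and `S₀ = 𝒮 0`. Then `X` has a resolution of singularities.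
[cite: Kato1994, (10.4)] [cite: Kollar2007, §2.2] [folklore; cite: SGA3, Exp. VIII §4–5] -/
theorem hasResolution_of_isolated_quotient_charts_of_rational_points (K : Type) [Field K]
    (X : Scheme.{0}) [IsIntegral X] (f : X ⟶ Spec (.of K)) [LocallyOfFiniteType f]
    (hfin : (Scheme.regularLocus X)ᶜ.Finite)
    (hq : ∀ x : X, x ∉ Scheme.regularLocus X →
      ∃ (A : Type) (_ : AddCommGroup A) (_ : Finite A) (_ : DecidableEq A)
        (S : Type) (_ : CommRing S) (_ : Algebra K S) (𝒮 : A → Submodule K S)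
        (_ : GradedAlgebra 𝒮), Algebra.FiniteType K S ∧ IsRegularRing S ∧
        ∃ (φ : Spec (.of (𝒮 0)) ⟶ X) (_ : Etale φ)
          (_ : φ ≫ f = Spec.map (CommRingCat.ofHom (algebraMap K (𝒮 0)))) (v : Spec (.of (𝒮 0))), φ v = x ∧
          ∀ c : (Spec (.of (𝒮 0))).presheaf.stalk v, ∃ a : Γ(Spec (.of K), ⊤),
            c - ((Spec (.of (𝒮 0))).presheaf.germ ⊤ v trivial).hom
              ((Spec.map (CommRingCat.ofHom (algebraMap K (𝒮 0)))).appTop.hom a) ∈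
              IsLocalRing.maximalIdeal ((Spec (.of (𝒮 0))).presheaf.stalk v)) :
    Scheme.HasResolution X := by
  refine IsolatedQuotientResolutionField.hasResolution_of_isolated_quotient_charts K X f hfin fun x hx => ?_
  obtain ⟨A, iA, fA, dA, S, iS, aS, 𝒮, gS, hft, hregS, φ, hφ, hφK, v, hv, hrat⟩ := hq x hx
  exact ⟨A, iA, fA, dA, S, iS, aS, 𝒮, gS, hft, hregS, φ, hφ, v, hv,
    residue_condition_of_rational_point f _ φ hφK v hrat⟩

/-- **Ring form of `K`-rationality on an affine open.** If `v` lies in an affine open `V` and every section over `V` is congruent modulo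
`𝔮_v` to a constant pulled back from `Spec K` (i.e. `K → Γ(Y, V)/𝔮_v` is onto), then `v` is `K`-rational in the germ form used by
`residue_condition_of_rational_point` (germs are fractions `s/t`; the constant is `a₁ a₂⁻¹`). [folklore] -/
theorem rational_germ_condition_of_affineOpen {K : Type} [Field K] {Y : Scheme.{0}} (g : Y ⟶ Spec (.of K)) (v : Y)
    (V : Y.Opens) (hV : IsAffineOpen V) (hvV : v ∈ V)
    (hsurj : ∀ s : Γ(Y, V), ∃ a : Γ(Spec (.of K), ⊤),
      s - (g.appLE ⊤ V le_top).hom a ∈ (hV.primeIdealOf ⟨v, hvV⟩).asIdeal) :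
    ∀ c : Y.presheaf.stalk v, ∃ a : Γ(Spec (.of K), ⊤),
      c - (Y.presheaf.germ ⊤ v trivial).hom (g.appTop.hom a) ∈ IsLocalRing.maximalIdeal (Y.presheaf.stalk v) := by
  classical
  intro c
  set 𝔮 := hV.primeIdealOf ⟨v, hvV⟩ with h𝔮def
  letI := Y.presheaf.algebra_section_stalk ⟨v, hvV⟩
  haveI := hV.isLocalization_stalk ⟨v, hvV⟩
  -- the constants, as a ring map into the stalk, factor through `Γ(Y, V)`
  set θ : Γ(Spec (.of K), ⊤) →+* Y.presheaf.stalk v :=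
    (Y.presheaf.germ ⊤ v trivial).hom.comp g.appTop.hom with hθdef
  have hθ : ∀ a, θ a = algebraMap Γ(Y, V) (Y.presheaf.stalk v) ((g.appLE ⊤ V le_top).hom a) := by
    intro a
    change (Y.presheaf.germ ⊤ v trivial).hom (g.appTop.hom a) =
      (Y.presheaf.germ V v hvV).hom ((g.appLE ⊤ V le_top).hom a)
    rw [Scheme.Hom.appLE, CommRingCat.comp_apply, TopCat.Presheaf.germ_res_apply]
    rfl
  -- `Γ(Spec K, ⊤) ≅ K` is a field: nonzero constants are units
  let e : Γ(Spec (.of K), ⊤) ≃+* K := (Scheme.ΓSpecIso (.of K)).commRingCatIsoToRingEquiv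
  have hunit : ∀ a : Γ(Spec (.of K), ⊤), a ≠ 0 → IsUnit a := by
    intro a ha
    rw [← isUnit_map_iff e a]
    exact isUnit_iff_ne_zero.mpr fun h => ha (e.map_eq_zero_iff.mp h)
  -- write `c = s / t`
  obtain ⟨⟨s, t⟩, hct⟩ := IsLocalization.surj 𝔮.asIdeal.primeCompl c
  obtain ⟨a₁, ha₁⟩ := hsurj s
  obtain ⟨a₂, ha₂⟩ := hsurj (t : Γ(Y, V))
  have ha₂0 : a₂ ≠ 0 := by
    rintro rfl
    rw [map_zero, sub_zero] at ha₂
    exact t.2 ha₂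
  have hu : IsUnit a₂ := hunit a₂ ha₂0
  refine ⟨a₁ * ↑hu.unit⁻¹, ?_⟩
  change c - θ (a₁ * ↑hu.unit⁻¹) ∈ IsLocalRing.maximalIdeal (Y.presheaf.stalk v)
  have hinv : θ ↑hu.unit⁻¹ * θ a₂ = 1 := by
    rw [← map_mul, hu.val_inv_mul, map_one]
  -- compute in the residue field
  set r := IsLocalRing.residue (Y.presheaf.stalk v) with hrdef
  rw [← IsLocalRing.residue_eq_zero_iff, map_sub, map_mul]
  have h1 : r (algebraMap Γ(Y, V) (Y.presheaf.stalk v) s) = r (θ a₁) := by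
    rw [← sub_eq_zero, ← map_sub, IsLocalRing.residue_eq_zero_iff, hθ, ← map_sub]
    exact (IsLocalization.AtPrime.to_map_mem_maximal_iff (Y.presheaf.stalk v) 𝔮.asIdeal _).mpr ha₁
  have h2 : r (algebraMap Γ(Y, V) (Y.presheaf.stalk v) (t : Γ(Y, V))) = r (θ a₂) := by
    rw [← sub_eq_zero, ← map_sub, IsLocalRing.residue_eq_zero_iff, hθ, ← map_sub]
    exact (IsLocalization.AtPrime.to_map_mem_maximal_iff (Y.presheaf.stalk v) 𝔮.asIdeal _).mpr ha₂
  have hθ2 : r (θ a₂) ≠ 0 := by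
    rw [← h2, Ne, IsLocalRing.residue_eq_zero_iff,
      IsLocalization.AtPrime.to_map_mem_maximal_iff (Y.presheaf.stalk v) 𝔮.asIdeal]
    exact t.2
  have hc : r c * r (θ a₂) = r (θ a₁) := by
    rw [← h2, ← map_mul, hct, h1]
  have hinv' : r (θ ↑hu.unit⁻¹) * r (θ a₂) = 1 := by
    rw [← map_mul, hinv, map_one]
  have hc' : r c = r (θ a₁) * r (θ ↑hu.unit⁻¹) := by
    have hi : r (θ ↑hu.unit⁻¹) = (r (θ a₂))⁻¹ := eq_inv_of_mul_eq_one_left hinv'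
    rw [hi, ← div_eq_mul_inv, eq_div_iff hθ2, hc]
  rw [hc', map_mul, sub_self]

/-- **Ring form of the rational-points theorem**: as `hasResolution_of_isolated_quotient_charts_of_rational_points`, with the `K`-rationality of
the chart point `v ∈ Spec S₀` expressed on the affine open `⊤`: every global section of `Spec S₀` is congruent modulo `𝔮_v` to a constant.
[cite: Kato1994, (10.4)] [folklore; cite: Kollar2007, §2.2] -/
theorem hasResolution_of_isolated_quotient_charts_of_rational_points' (K : Type) [Field K]
    (X : Scheme.{0}) [IsIntegral X] (f : X ⟶ Spec (.of K)) [LocallyOfFiniteType f]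
    (hfin : (Scheme.regularLocus X)ᶜ.Finite)
    (hq : ∀ x : X, x ∉ Scheme.regularLocus X →
      ∃ (A : Type) (_ : AddCommGroup A) (_ : Finite A) (_ : DecidableEq A)
        (S : Type) (_ : CommRing S) (_ : Algebra K S) (𝒮 : A → Submodule K S)
        (_ : GradedAlgebra 𝒮), Algebra.FiniteType K S ∧ IsRegularRing S ∧
        ∃ (φ : Spec (.of (𝒮 0)) ⟶ X) (_ : Etale φ)
          (_ : φ ≫ f = Spec.map (CommRingCat.ofHom (algebraMap K (𝒮 0)))) (v : Spec (.of (𝒮 0))), φ v = x ∧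
          ∀ s : Γ(Spec (.of (𝒮 0)), ⊤), ∃ a : Γ(Spec (.of K), ⊤),
            s - ((Spec.map (CommRingCat.ofHom (algebraMap K (𝒮 0)))).appLE ⊤ ⊤ le_top).hom a ∈
              ((isAffineOpen_top (Spec (.of (𝒮 0)))).primeIdealOf ⟨v, trivial⟩).asIdeal) :
    Scheme.HasResolution X := by
  refine hasResolution_of_isolated_quotient_charts_of_rational_points K X f hfin fun x hx => ?_
  obtain ⟨A, iA, fA, dA, S, iS, aS, 𝒮, gS, hft, hregS, φ, hφ, hφK, v, hv, hrat⟩ := hq x hx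
  exact ⟨A, iA, fA, dA, S, iS, aS, 𝒮, gS, hft, hregS, φ, hφ, hφK, v, hv,
    rational_germ_condition_of_affineOpen _ v ⊤ (isAffineOpen_top _) trivial hrat⟩

end Summit.ResolutionOfSingularities.ResolutionOfSingularities.Theorems.FRationalResolution.IsolatedQuotientResolutionRational

end
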